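import Summits.CriticalPhenomena.PercolationContinuityZ3.Theorems.PercNearOneGluingNoHeavyLowerTailKnQuestion8CoefficientwiseGluing
import Literature.Probability.Percolation.KozmaNitzanSeparatingTriple
import HarnessLib

/-!
# Root regrouping of the first-rung kernel (prim-lf-2 gen 30): the deletion–contraction square at one edge

Support file (`--supports stmt-CriticalPhenomena-4575`, closed), prover `prim-lf-2` (gen 30).  No definitions, no named facts, no sorries; standard axioms.
Memo `prim-lf-2/CW-ROOT-gen30.md` §1–§2.

Setting (as in `…CoefficientwiseGluing/Doubling.lean`): a finite multigraph is an end-point map `ends : ι → Sym2 V` and an edge set `E : Finset ι`; a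
two-colouring is `t ⊆ E` (red) with blue edges `E ∖ t`; `C_x(t) = openCluster (ends '' t) x` is the red cluster of `x`; the first-rung form of the pair
`(E; x, z)` at monotone `f, g : Set V → ℝ` is
  `T'(E)[f,g] = Σ_{t ⊆ E : z ∉ C_x(t), z ∉ C_x(E∖t)} (f(C_x t) − f(C_x(E∖t)))·(g(C_x t) − g(C_x(E∖t)))`.

Fix an edge `e ∈ E`, put `E' = E ∖ {e}` and, for `s ⊆ E'`, the four clusters `Kc = C_x(s ∪ e) ⊇ Kd = C_x(s)`, `Lc = C_x((E'∖s) ∪ e) ⊇ Ld = C_x(E'∖s)`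
(`c` = `e` conducting in that colour, `d` = `e` deleted).  Splitting `T'(E)` by the colour of `e` and sorting the configurations `s` by whether `e` is
pivotal for the event `S = {no monochromatic x–z path}` gives the exact **ROOT REGROUPING IDENTITY** (`Coefficientwise.rootRegroup_sum`):
  `T'(E)[f,g] = Σ_{s : z ∉ Kc, z ∉ Lc} [Φ(Kc,Lc) + Φ(Kd,Ld) + X(s)] + Σ_{s : z ∈ Kc∖Kd, z ∉ Lc} Φ(Kd,Lc) + Σ_{s : z ∈ Lc∖Ld, z ∉ Kc} Φ(Kc,Ld)`,
where `Φ(A,B) = (f A − f B)(g A − g B)` and `X(s) = (f Kc − f Kd)(g Lc − g Ld) + (f Lc − f Ld)(g Kc − g Kd)` is the cross term of the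
**deletion–contraction square** `Φ(Kc,Ld) + Φ(Kd,Lc) = Φ(Kc,Lc) + Φ(Kd,Ld) + X` (`Coefficientwise.dcSquare`, gen 29 §4.2).  The first sum is
`T'` of the contraction `E/e` (both colours conduct through `e`, on the vertex set of `E`: `{z ∉ Kc, z ∉ Lc} = S(E/e)`) plus the first-rung summands of
the deletion `E ∖ e` restricted to `S(E/e)` plus the nonnegative `X`; the last two sums are the `e`-PIVOTAL configurations, exchanged by the colour
swap `s ↦ E'∖s` (`Coefficientwise.rootRegroup_pivotal_swap`), so that for monotone `f, g` (`Coefficientwise.firstRung_ge_pieces`)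
  `T'(E)[f,g] ≥ T'(E/e)[f,g] + Σ_{S(E/e)} Φ(Kd,Ld) + 2·Σ_{s : z ∈ Kc∖Kd, z ∉ Lc} Φ(Kd,Lc)`.
For a ROOT edge `e = {x,a}` the pivotal condition `z ∈ Kc ∖ Kd` says exactly that `a` lies in the red cluster of `z`
(`Coefficientwise.mem_insert_root_iff`), so the last sum is the first-rung kernel of `E` restricted to `{e blue, a ∈ C_z(red)}` — the piece `RZ_a`
of the memo; iterating over the neighbours of `x` reduces CW-PA for all finite multigraphs to the positivity of the kernels restricted to
`{every neighbour of x is joined to z}` (memo §2, THEOREM R30; census §3).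
[cite: KozmaNitzan2024, Questions 8–9 (§5.5 p. 36) (context: first rung of the coefficientwise programme for Question 8)]
-/

namespace Summit.CriticalPhenomena.PercolationContinuityZ3.Theorems

open Finset Literature.Probability.Percolation

namespace Coefficientwise

variable {ι V : Type*}

/-- **The deletion–contraction square** (pointwise algebra, gen 29 §4.2): for any `f, g` and four sets,
`Φ(Kc,Ld) + Φ(Kd,Lc) = Φ(Kc,Lc) + Φ(Kd,Ld) + [(f Kc − f Kd)(g Lc − g Ld) + (f Lc − f Ld)(g Kc − g Kd)]`.
[cite: KozmaNitzan2024, §5.5 (context only; elementary algebra)] -/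
theorem dcSquare (f g : Set V → ℝ) (Kc Kd Lc Ld : Set V) :
    (f Kc - f Ld) * (g Kc - g Ld) + (f Kd - f Lc) * (g Kd - g Lc) =
      (f Kc - f Lc) * (g Kc - g Lc) + (f Kd - f Ld) * (g Kd - g Ld) +
        ((f Kc - f Kd) * (g Lc - g Ld) + (f Lc - f Ld) * (g Kc - g Kd)) := by
  ring

/-- The cross term of the deletion–contraction square is nonnegative for monotone `f, g` and nested clusters `Kd ⊆ Kc`, `Ld ⊆ Lc`.
[cite: KozmaNitzan2024, §5.5 (context only; elementary)] -/
theorem dcSquare_cross_nonneg (f g : Set V → ℝ) (hf : Monotone f) (hg : Monotone g) {Kc Kd Lc Ld : Set V}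
    (hK : Kd ⊆ Kc) (hL : Ld ⊆ Lc) :
    0 ≤ (f Kc - f Kd) * (g Lc - g Ld) + (f Lc - f Ld) * (g Kc - g Kd) := by
  have h1 : 0 ≤ f Kc - f Kd := sub_nonneg.mpr (hf hK)
  have h2 : 0 ≤ g Lc - g Ld := sub_nonneg.mpr (hg hL)
  have h3 : 0 ≤ f Lc - f Ld := sub_nonneg.mpr (hf hL)
  have h4 : 0 ≤ g Kc - g Kd := sub_nonneg.mpr (hg hK)
  positivity

open Classical in
/-- **Root regrouping, pointwise.**  For nested clusters `Kd ⊆ Kc`, `Ld ⊆ Lc` (the red/blue clusters of `x` without/with the edge `e`) and the target `z`,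
the two first-rung summands of the configurations `s ∪ {e red}` and `s ∪ {e blue}` regroup as: the non-pivotal case `z ∉ Kc, z ∉ Lc` (both colourings of
`e` are admissible) carrying the deletion–contraction square, plus the two one-colour-pivotal cases; the doubly-pivotal case contributes nothing.
[cite: KozmaNitzan2024, Questions 8–9 (§5.5 p. 36) (context)] -/
theorem rootRegroup_pointwise (f g : Set V → ℝ) {Kc Kd Lc Ld : Set V} (z : V) (hK : Kd ⊆ Kc) (hL : Ld ⊆ Lc) :
    ((if z ∉ Kc ∧ z ∉ Ld then (f Kc - f Ld) * (g Kc - g Ld) else 0) +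
        (if z ∉ Kd ∧ z ∉ Lc then (f Kd - f Lc) * (g Kd - g Lc) else 0)) =
      (if z ∉ Kc ∧ z ∉ Lc then
          (f Kc - f Lc) * (g Kc - g Lc) + (f Kd - f Ld) * (g Kd - g Ld) +
            ((f Kc - f Kd) * (g Lc - g Ld) + (f Lc - f Ld) * (g Kc - g Kd))
        else 0) +
        (if z ∈ Kc ∧ z ∉ Kd ∧ z ∉ Lc then (f Kd - f Lc) * (g Kd - g Lc) else 0) +
        (if z ∈ Lc ∧ z ∉ Ld ∧ z ∉ Kc then (f Kc - f Ld) * (g Kc - g Ld) else 0) := by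
  by_cases hc : z ∈ Kc <;> by_cases hd : z ∈ Kd <;> by_cases hlc : z ∈ Lc <;> by_cases hld : z ∈ Ld
  all_goals first
    | exact absurd (hK hd) hc
    | exact absurd (hL hld) hlc
    | (simp [hc, hd, hlc, hld]; done)
    | (simp [hc, hd, hlc, hld]; ring)

section graph

variable [DecidableEq ι]

/-- For `s ⊆ E ∖ {e}`: the blue edges of the colouring `s ∪ {e}` of `E` are `(E ∖ {e}) ∖ s`. [cite: KozmaNitzan2024, §5.5 (context only; bookkeeping)] -/
theorem sdiff_insert_eq_erase_sdiff (E s : Finset ι) (e : ι) :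
    E \ insert e s = E.erase e \ s := by
  ext i
  simp only [Finset.mem_sdiff, Finset.mem_insert, Finset.mem_erase, not_or]
  constructor
  · rintro ⟨hiE, hne, his⟩; exact ⟨⟨hne, hiE⟩, his⟩
  · rintro ⟨⟨hne, hiE⟩, his⟩; exact ⟨hiE, hne, his⟩

/-- For `s ⊆ E ∖ {e}` with `e ∈ E`: the blue edges of the colouring `s` of `E` are `((E ∖ {e}) ∖ s) ∪ {e}`.
[cite: KozmaNitzan2024, §5.5 (context only; bookkeeping)] -/
theorem sdiff_eq_insert_erase_sdiff {E s : Finset ι} {e : ι} (he : e ∈ E) (hs : s ⊆ E.erase e) :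
    E \ s = insert e (E.erase e \ s) := by
  ext i
  simp only [Finset.mem_sdiff, Finset.mem_insert, Finset.mem_erase]
  constructor
  · rintro ⟨hiE, his⟩
    by_cases hie : i = e
    · exact Or.inl hie
    · exact Or.inr ⟨⟨hie, hiE⟩, his⟩
  · rintro (rfl | ⟨⟨_, hiE⟩, his⟩)
    · exact ⟨he, fun h => by simpa using (Finset.mem_erase.mp (hs h)).1⟩
    · exact ⟨hiE, his⟩

open Classical in
/-- **ROOT REGROUPING IDENTITY** (prim-lf-2 gen 30, memo CW-ROOT-gen30 §1).  For an edge `e ∈ E`, `E' = E ∖ {e}`, and the four clusters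
`Kc = C_x(s ∪ e)`, `Kd = C_x(s)`, `Lc = C_x((E'∖s) ∪ e)`, `Ld = C_x(E'∖s)` of `s ⊆ E'`:
`T'(E)[f,g] = Σ_{s ⊆ E'} { 1[z∉Kc, z∉Lc]·(Φ(Kc,Lc) + Φ(Kd,Ld) + X(s)) + 1[z∈Kc∖Kd, z∉Lc]·Φ(Kd,Lc) + 1[z∈Lc∖Ld, z∉Kc]·Φ(Kc,Ld) }` — valid for ALL
`f, g` (no monotonicity).  [cite: KozmaNitzan2024, Questions 8–9 (§5.5 p. 36) (context)] -/
theorem rootRegroup_sum (ends : ι → Sym2 V) (E : Finset ι) {e : ι} (he : e ∈ E) (x z : V) (f g : Set V → ℝ) :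
    ∑ t ∈ E.powerset,
        (if z ∉ openCluster (ends '' (↑t : Set ι)) x ∧ z ∉ openCluster (ends '' (↑(E \ t) : Set ι)) x then
          (f (openCluster (ends '' (↑t : Set ι)) x) - f (openCluster (ends '' (↑(E \ t) : Set ι)) x)) *
            (g (openCluster (ends '' (↑t : Set ι)) x) - g (openCluster (ends '' (↑(E \ t) : Set ι)) x))
        else 0) =
      ∑ s ∈ (E.erase e).powerset,
        ((if z ∉ openCluster (ends '' (↑(insert e s) : Set ι)) x ∧
              z ∉ openCluster (ends '' (↑(insert e (E.erase e \ s)) : Set ι)) x then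
            (f (openCluster (ends '' (↑(insert e s) : Set ι)) x) - f (openCluster (ends '' (↑(insert e (E.erase e \ s)) : Set ι)) x)) *
                (g (openCluster (ends '' (↑(insert e s) : Set ι)) x) - g (openCluster (ends '' (↑(insert e (E.erase e \ s)) : Set ι)) x)) +
              (f (openCluster (ends '' (↑s : Set ι)) x) - f (openCluster (ends '' (↑(E.erase e \ s) : Set ι)) x)) *
                (g (openCluster (ends '' (↑s : Set ι)) x) - g (openCluster (ends '' (↑(E.erase e \ s) : Set ι)) x)) +
              ((f (openCluster (ends '' (↑(insert e s) : Set ι)) x) - f (openCluster (ends '' (↑s : Set ι)) x)) *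
                  (g (openCluster (ends '' (↑(insert e (E.erase e \ s)) : Set ι)) x) - g (openCluster (ends '' (↑(E.erase e \ s) : Set ι)) x)) +
                (f (openCluster (ends '' (↑(insert e (E.erase e \ s)) : Set ι)) x) - f (openCluster (ends '' (↑(E.erase e \ s) : Set ι)) x)) *
                  (g (openCluster (ends '' (↑(insert e s) : Set ι)) x) - g (openCluster (ends '' (↑s : Set ι)) x)))
          else 0) +
          (if z ∈ openCluster (ends '' (↑(insert e s) : Set ι)) x ∧ z ∉ openCluster (ends '' (↑s : Set ι)) x ∧
                z ∉ openCluster (ends '' (↑(insert e (E.erase e \ s)) : Set ι)) x then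
            (f (openCluster (ends '' (↑s : Set ι)) x) - f (openCluster (ends '' (↑(insert e (E.erase e \ s)) : Set ι)) x)) *
              (g (openCluster (ends '' (↑s : Set ι)) x) - g (openCluster (ends '' (↑(insert e (E.erase e \ s)) : Set ι)) x))
          else 0) +
          (if z ∈ openCluster (ends '' (↑(insert e (E.erase e \ s)) : Set ι)) x ∧ z ∉ openCluster (ends '' (↑(E.erase e \ s) : Set ι)) x ∧
                z ∉ openCluster (ends '' (↑(insert e s) : Set ι)) x then
            (f (openCluster (ends '' (↑(insert e s) : Set ι)) x) - f (openCluster (ends '' (↑(E.erase e \ s) : Set ι)) x)) *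
              (g (openCluster (ends '' (↑(insert e s) : Set ι)) x) - g (openCluster (ends '' (↑(E.erase e \ s) : Set ι)) x))
          else 0)) := by
  set K : Finset ι → Set V := fun s => openCluster (ends '' (↑s : Set ι)) x with hK
  set E' : Finset ι := E.erase e with hE'
  -- the first-rung summand as a function of the red edge set
  set h : Finset ι → ℝ := fun t =>
    if z ∉ K t ∧ z ∉ K (E \ t) then (f (K t) - f (K (E \ t))) * (g (K t) - g (K (E \ t))) else 0 with hh
  change ∑ t ∈ E.powerset, h t = _
  -- split the colourings of `E` by the colour of `e`
  have hEe : E = insert e E' := by rw [hE', Finset.insert_erase he]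
  have heE' : e ∉ E' := by simp [hE']
  have hsplit : ∑ t ∈ E.powerset, h t = ∑ s ∈ E'.powerset, h s + ∑ s ∈ E'.powerset, h (insert e s) := by
    rw [hEe, Finset.sum_powerset_insert heE']
  rw [hsplit, ← Finset.sum_add_distrib]
  refine Finset.sum_congr rfl fun s hs => ?_
  have hsE' : s ⊆ E' := Finset.mem_powerset.mp hs
  -- identify the blue edge sets
  have hblue_red : E \ insert e s = E' \ s := sdiff_insert_eq_erase_sdiff E s e
  have hblue_blue : E \ s = insert e (E' \ s) := sdiff_eq_insert_erase_sdiff he hsE'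
  have hKd : K s ⊆ K (insert e s) := openCluster_image_mono ends (Finset.subset_insert e s) x
  have hLd : K (E' \ s) ⊆ K (insert e (E' \ s)) := openCluster_image_mono ends (Finset.subset_insert e _) x
  have key := rootRegroup_pointwise f g z hKd hLd
  simp only [hh, hblue_red, hblue_blue]
  rw [add_comm]
  exact key

open Classical in
/-- The two pivotal pieces of the root regrouping are exchanged by the colour swap `s ↦ E' ∖ s`; since `Φ(A,B) = Φ(B,A)` they are EQUAL.
[cite: KozmaNitzan2024, Questions 8–9 (§5.5 p. 36) (context)] -/
theorem rootRegroup_pivotal_swap (ends : ι → Sym2 V) (E' : Finset ι) (e : ι) (x z : V) (f g : Set V → ℝ) :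
    ∑ s ∈ E'.powerset,
        (if z ∈ openCluster (ends '' (↑(insert e (E' \ s)) : Set ι)) x ∧ z ∉ openCluster (ends '' (↑(E' \ s) : Set ι)) x ∧
              z ∉ openCluster (ends '' (↑(insert e s) : Set ι)) x then
          (f (openCluster (ends '' (↑(insert e s) : Set ι)) x) - f (openCluster (ends '' (↑(E' \ s) : Set ι)) x)) *
            (g (openCluster (ends '' (↑(insert e s) : Set ι)) x) - g (openCluster (ends '' (↑(E' \ s) : Set ι)) x))
        else 0) =
      ∑ s ∈ E'.powerset,
        (if z ∈ openCluster (ends '' (↑(insert e s) : Set ι)) x ∧ z ∉ openCluster (ends '' (↑s : Set ι)) x ∧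
              z ∉ openCluster (ends '' (↑(insert e (E' \ s)) : Set ι)) x then
          (f (openCluster (ends '' (↑s : Set ι)) x) - f (openCluster (ends '' (↑(insert e (E' \ s)) : Set ι)) x)) *
            (g (openCluster (ends '' (↑s : Set ι)) x) - g (openCluster (ends '' (↑(insert e (E' \ s)) : Set ι)) x))
        else 0) := by
  set K : Finset ι → Set V := fun s => openCluster (ends '' (↑s : Set ι)) x with hK
  set H : Finset ι → ℝ := fun s =>
    if z ∈ K (insert e s) ∧ z ∉ K s ∧ z ∉ K (insert e (E' \ s)) then
      (f (K s) - f (K (insert e (E' \ s)))) * (g (K s) - g (K (insert e (E' \ s)))) else 0 with hH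
  change _ = ∑ s ∈ E'.powerset, H s
  rw [← sum_powerset_sdiff E' H]
  refine Finset.sum_congr rfl fun s hs => ?_
  have hss : E' \ (E' \ s) = s := Finset.sdiff_sdiff_eq_self (Finset.mem_powerset.mp hs)
  simp only [hH, hss]
  split_ifs with h1
  · ring
  · rfl

open Classical in
/-- **The first rung dominates its three pieces** (gen 30, memo §1): for monotone `f, g` and an edge `e ∈ E`,
`T'(E)[f,g] ≥ T'(E/e)[f,g] + Σ_{S(E/e)} Φ(Kd,Ld) + 2·Σ_{s : z ∈ Kc∖Kd, z ∉ Lc} Φ(Kd,Lc)`,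
where `T'(E/e)` is written on the vertex set of `E` (the edge `e` conducting in both colours: clusters `Kc, Lc`, event `z ∉ Kc, z ∉ Lc`).
Hence CW-PA for `(E; x, z)` follows from the positivity of the contraction's first rung, of the deletion's first-rung kernel restricted to `S(E/e)`,
and of the `e`-pivotal restricted kernel — the induction step of THEOREM R30.  [cite: KozmaNitzan2024, Questions 8–9 (§5.5 p. 36) (context)] -/
theorem firstRung_ge_pieces (ends : ι → Sym2 V) (E : Finset ι) {e : ι} (he : e ∈ E) (x z : V) (f g : Set V → ℝ)
    (hf : Monotone f) (hg : Monotone g) :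
    (∑ s ∈ (E.erase e).powerset,
        (if z ∉ openCluster (ends '' (↑(insert e s) : Set ι)) x ∧ z ∉ openCluster (ends '' (↑(insert e (E.erase e \ s)) : Set ι)) x then
          (f (openCluster (ends '' (↑(insert e s) : Set ι)) x) - f (openCluster (ends '' (↑(insert e (E.erase e \ s)) : Set ι)) x)) *
            (g (openCluster (ends '' (↑(insert e s) : Set ι)) x) - g (openCluster (ends '' (↑(insert e (E.erase e \ s)) : Set ι)) x))
        else 0)) +
      (∑ s ∈ (E.erase e).powerset,
        (if z ∉ openCluster (ends '' (↑(insert e s) : Set ι)) x ∧ z ∉ openCluster (ends '' (↑(insert e (E.erase e \ s)) : Set ι)) x then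
          (f (openCluster (ends '' (↑s : Set ι)) x) - f (openCluster (ends '' (↑(E.erase e \ s) : Set ι)) x)) *
            (g (openCluster (ends '' (↑s : Set ι)) x) - g (openCluster (ends '' (↑(E.erase e \ s) : Set ι)) x))
        else 0)) +
      2 * (∑ s ∈ (E.erase e).powerset,
        (if z ∈ openCluster (ends '' (↑(insert e s) : Set ι)) x ∧ z ∉ openCluster (ends '' (↑s : Set ι)) x ∧
              z ∉ openCluster (ends '' (↑(insert e (E.erase e \ s)) : Set ι)) x then
          (f (openCluster (ends '' (↑s : Set ι)) x) - f (openCluster (ends '' (↑(insert e (E.erase e \ s)) : Set ι)) x)) *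
            (g (openCluster (ends '' (↑s : Set ι)) x) - g (openCluster (ends '' (↑(insert e (E.erase e \ s)) : Set ι)) x))
        else 0)) ≤
      ∑ t ∈ E.powerset,
        (if z ∉ openCluster (ends '' (↑t : Set ι)) x ∧ z ∉ openCluster (ends '' (↑(E \ t) : Set ι)) x then
          (f (openCluster (ends '' (↑t : Set ι)) x) - f (openCluster (ends '' (↑(E \ t) : Set ι)) x)) *
            (g (openCluster (ends '' (↑t : Set ι)) x) - g (openCluster (ends '' (↑(E \ t) : Set ι)) x))
        else 0) := by
  rw [rootRegroup_sum ends E he x z f g, two_mul]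
  nth_rewrite 1 [← rootRegroup_pivotal_swap ends (E.erase e) e x z f g]
  rw [← Finset.sum_add_distrib, ← Finset.sum_add_distrib, ← Finset.sum_add_distrib]
  refine Finset.sum_le_sum fun s _ => ?_
  have hKd : openCluster (ends '' (↑s : Set ι)) x ⊆ openCluster (ends '' (↑(insert e s) : Set ι)) x :=
    openCluster_image_mono ends (Finset.subset_insert e s) x
  have hLd : openCluster (ends '' (↑(E.erase e \ s) : Set ι)) x ⊆ openCluster (ends '' (↑(insert e (E.erase e \ s)) : Set ι)) x :=
    openCluster_image_mono ends (Finset.subset_insert e _) x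
  have hX := dcSquare_cross_nonneg f g hf hg hKd hLd
  split_ifs <;> linarith

/-- The red edges of `s ∪ {e}` are those of `s` together with the ends of `e`. [cite: KozmaNitzan2024, §5.5 (context only; bookkeeping)] -/
theorem image_coe_insert (ends : ι → Sym2 V) (e : ι) (s : Finset ι) :
    ends '' (↑(insert e s) : Set ι) = insert (ends e) (ends '' (↑s : Set ι)) := by
  rw [Finset.coe_insert, Set.image_insert_eq]

/-- **Pivotality at a root edge is a `z`-side event.**  If `e` has ends `{x, a}`, then `z` lies in the red cluster of `x` for `s ∪ {e}` but not for `s`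
iff `z ∉ C_x(s)` and `a` is joined to `z` by a red path of `s` (i.e. `a ∈ C_z(s)`): the extra configurations are exactly those in which the far end of
the root edge is red-joined to `z`.  [cite: KozmaNitzan2024, §5.5 (context only; folklore)] -/
theorem mem_insert_root_iff (ends : ι → Sym2 V) {e : ι} {x a : V} (he : ends e = s(x, a)) (s : Finset ι) (z : V) :
    (z ∈ openCluster (ends '' (↑(insert e s) : Set ι)) x ∧ z ∉ openCluster (ends '' (↑s : Set ι)) x) ↔
      (z ∉ openCluster (ends '' (↑s : Set ι)) x ∧ a ∈ openCluster (ends '' (↑s : Set ι)) z) := by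
  have key : z ∈ openCluster (ends '' (↑(insert e s) : Set ι)) x ↔
      (openGraph (ends '' (↑s : Set ι))).Reachable x z ∨ (openGraph (ends '' (↑s : Set ι))).Reachable a z := by
    change (openGraph (ends '' (↑(insert e s) : Set ι))).Reachable x z ↔ _
    rw [image_coe_insert, he, KNSep.reachable_insert_iff]
    constructor
    · rintro (h | ⟨_, h⟩ | ⟨_, h⟩)
      · exact Or.inl h
      · exact Or.inr h
      · exact Or.inl h
    · rintro (h | h)
      · exact Or.inl h
      · exact Or.inr (Or.inl ⟨SimpleGraph.Reachable.refl x, h⟩)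
  constructor
  · rintro ⟨hz, hz'⟩
    refine ⟨hz', ?_⟩
    rcases key.mp hz with h | h
    · exact absurd h hz'
    · exact h.symm
  · rintro ⟨hz', ha⟩
    exact ⟨key.mpr (Or.inr (SimpleGraph.Reachable.symm ha)), hz'⟩

end graph

end Coefficientwise

end Summit.CriticalPhenomena.PercolationContinuityZ3.Theorems
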